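import Literature.MathematicalPhysics.QuantumFieldTheory.BalabanImbrieJaffe1984to88.BIJ88DeltaLocClose235General
import Literature.MathematicalPhysics.QuantumFieldTheory.BalabanImbrieJaffe1984to88.BIJ85NeumannPropagatorRegularDecay
import Literature.MathematicalPhysics.QuantumFieldTheory.Balaban1983to89.B3Bound323ZeroTorus

/-!
# `BalabanImbrieJaffe1984to88.BIJ88Decay236RegularRegion` — T. Bałaban, J. Imbrie, A. Jaffe, *Effective action and cluster properties of the
abelian Higgs model*, Commun. Math. Phys. **114** (1988) 257–315 [BalabanImbrieJaffe1988], Sect. 2 p. 263 [PDF 7], **(2.36) FOR THE REGION FORM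
`Δ_k(Ω,u)` AT A (2.23)-REGULAR NON-FLAT BACKGROUND `u = e^{ieεA}`, HYPOTHESIS-FREE** — the first INSTANTIATION of this seat's general-background
chain `BIJ88DeltaLocClose235General` (§10, the row-restricted `_gen` family) at a genuinely non-flat `u`: r01 g25's [6] (1.10) value member
`BIJ85NeumannPropagatorRegularDecay.norm_gBox_mulVec_le` for `G_k(Ω, e^{ieεA})` on the rows deep inside a big-block region `Ω` where `A` is
(2.23)-regular IS the input (H1.10″) of `decay236_region_gen` — one `exact` up to the metric dictionary `B3Bound323ZeroTorus.T_eq_supDist` and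
the order of the factors — whence the printed `|Δ_k(Ω,u;x₁,x₂)| ≤ ce^{−c|x₁−x₂|}` shape (2.36) for gen 15's `deltaRegion (α_kL^{kd}) ε⁻¹ (e^{ieεA}) k Ω`
at every entry `(y₁, y₂)` whose row block `B^k(y₁)` lies at the printed depth inside `Ω`.

statement-level skeleton of published theorems with citation tags; proofs where landed; nothing here is a claim about the Yang–Mills mass gap

PDF held: `paper:balaban1988-cmp114-bij-abelian-higgs-effective-action` (journal page = PDF page + 256); p. 263 [PDF 7] as quoted in this seat's
`BIJ88DeltaLocClose235General` / gen 17's headers; [I] = [BalabanImbrieJaffe1985] (CMP **97**) §7.3 p. 326 [PDF 28] *"The propagators arising from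
Δ_k(u_k) … also satisfy the regularity and decay estimates of [7]"* as quoted in r01's `BIJ85NeumannPropagatorRegularDecay`; [6] =
[Balaban1983RegularityDecay] (CMP **89**) p. 573.

CITATION HEADER (lean-in-tree rule).  Part of the lit-balaban TYPED SKELETON (HOME `run/shared/lean/pub/lit-balaban/`), PHASE-2 proof seat p31
gen 20 (unit `lit-balaban-p31-g20`; free-target protocol G.5-34(d), follow-up of TAKING #3: the announced *"instantiate by name the moment they
land"* — r01's (H1.10″) provider p344821 HAS landed).  WHAT IS REPRODUCED: row **C2.Eq2.36** (`HOME/lit-balaban-r18/ROWS-C2.md`, owner r18; head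
unchanged = p02's `decay236_of_opDecay`) as the located member FOR THE REGION FORM AT A (2.23)-REGULAR NON-FLAT BACKGROUND (gen 17's
`decay236_region_flat_level` was the flat member, gen 19's `BIJ88DeltaRegionSmallField236` the whole-torus member at the [I] (4.5.4) backgrounds);
the [6]-input row **B4.Thm@573** (1.10) (owner r01) enters BY NAME through r01's member.  Kind «model-level theorems only» (no definition, no
`Prop`-valued fact).

THE PRINTED TEXT (verbatim, p. 263 [PDF 7]).  *"|Δ_{k,loc}(u;x₁,x₂)| ≦ ce^{−c|x₁−x₂|}, (2.36)"* — for the comparison object `Δ_k(Ω,u)` of (2.35)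
([I] (4.6.4)), under *"for (2.31) we assume smoothness throughout the subset Ω ⊂ T_η"*; [6] p. 573: the estimates hold *"for x with
dist(x, Ω^c) ≥ R₀"*.

WHAT IS PROVED (theorems only; 0 `sorry`; standard axioms).
* **`input110_regular`** — r01's `norm_gBox_mulVec_le` READ AS (H1.10″): with r01's constants (`s ≥ s₀(d,L,a,creg,β)`, `c₀, e₁ > 0`), on every
  torus with `P.d = d`, `P.L = L`, `1 ≤ k ≤ K`, `k + s ≤ m + K`, `3L^kL^s ≤ |T|`, every big-block union `Ω` (blocks `L^k·L^s`), every `A` with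
  `0 < e_k ≤ e₁` (2.23)-regular on `Ω`:  for the rows `x` with the ball `{|y − x|_∞ ≤ R₀}` inside `Ω`
  (`R₀ = 2(5L^kL^s/8 + L^k) + 2L^kL^s(d+1)`, integer divisions as printed by r01), every source `‖f‖ ≤ F` at sup-torus distance `≥ D ≥ 0` from `x`:
  `‖(G_k(Ω,e^{ieεA})f)(x)‖ ≤ s_k²·c₀·e^{−(1/(4L^s))·D/L^k}·F` — the shape (H1.10″) of `BIJ88DeltaLocClose235General` §10 with `δ₀ = 1/(4L^s)` and
  the row set `X₀ = {x | ball ⊆ Ω}` (`T_eq_supDist`, reorder of factors).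
* **`decay236_region_regular`** — (2.36) FOR `Δ_k(Ω, e^{ieεA})`: at the same data, for all `y₁, y₂ ∈ T^{(k)}` with every `x ∈ B^k(y₁)` having its
  `R₀`-ball inside `Ω`:  `‖Δ_k(Ω,e^{ieεA}; y₁,y₂)‖ ≤ A·([y₁ = y₂] + a_k·c₀e^{1/(4L^s)}·e^{−|y₁−y₂|_{T^{(k)}}/(4L^s)})`, `A = α_kL^{kd}` (gen 15's
  counting normalization), `|·|_{T^{(k)}}` the unit-lattice sup torus distance — `decay236_region_gen` BY NAME on `input110_regular`.
HONEST SCOPE.  (i) Only (2.36) for the REGION form: the other members of the chain at this background ((2.31)/(2.35)/(2.38)/(2.40)/(2.41)/(4.9))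
need in addition (H1.12″) for the cubes — r01 g26's announced `BIJ85NeumannPropagatorRegularClose` — and (H1.10″) for the cubes; they will be
the same one-line instantiations of `…_gen` when those land.  (ii) The decay rate is r01's `1/(4L^s)` per `L^k` fine steps (unit-lattice rate
`1/(4L^s)`, `s ≥ s₀` fixed by `(d, L, a, creg, β)`), i.e. print's `c` depends on the big-block parameter `s`; the constant `c₀` and the charge
threshold `e₁` likewise (r01's HONEST SCOPE).  (iii) Rows: the printed depth restriction *"dist(x, Ω^c) ≥ R₀"* with r01's `R₀`; no statement at
rows closer to `∂Ω`.  (iv) Background `u = e^{ieεA}` exactly (r01's `expGauge P e A`); its gauge transforms follow from gen 15's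
`deltaRegion_gaugeAct` and are not spelled out.  (v) Fine level `0`, `P.d = d ≥ 1` directions (r01's convention: `d` = number of directions).
Imports: this seat's `BIJ88DeltaLocClose235General` (v1.1), r01's `BIJ85NeumannPropagatorRegularDecay`, r15/p26's `B3Bound323ZeroTorus` (the
metric dictionary).  Literature + Mathlib only.  Unit `lit-balaban-p31` (literature-prover-lit-balaban-p31-g20-0), 2026-08-23.  NOT summit progress.
-/

open scoped BigOperators Matrix ComplexConjugate
open Finset Matrix

namespace Literature.MathematicalPhysics.QuantumFieldTheory.BalabanImbrieJaffe1984to88.BIJ88Decay236RegularRegion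

open Literature.MathematicalPhysics.QuantumFieldTheory.Balaban1983to89
open BIJ88Sect3Statements (U1)
open BIJ85BlockAveragesTorus BIJ85BlockAveragesTorusK
open BIJ88NeumannPropagator227Torus (gBox)
open BIJ88DeltaLoc234Torus (deltaRegion)
open BIJ85CovariantHiggsDictionary (expGauge)
open BIJ85NeumannPropagatorRegularDecay (norm_gBox_mulVec_le)
open BIJ88DeltaLocClose235General (decay236_region_gen)
open B3Bound323ZeroTorus (T_eq_supDist)

noncomputable section

/-- **r01's [6] (1.10) VALUE MEMBER AT A (2.23)-REGULAR `u = e^{ieεA}`, READ AS THE INPUT SHAPE (H1.10″)** of `BIJ88DeltaLocClose235General` §10: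
on the row set `X₀ = {x | {|y−x|_∞ ≤ R₀} ⊆ Ω}`, rate `δ₀ = 1/(4L^s)` per `L^k` fine steps, r01's constants; the sup-torus metric
`B5Ineq137Torus.T P 0 = |·|_∞` by `T_eq_supDist`. [cite: Balaban1983RegularityDecay, (1.10) p.573] -/
theorem input110_regular (d L : ℕ) (hd : 1 ≤ d) (hL : 2 ≤ L) {a : ℝ} (ha : 0 < a) (e creg β : ℝ) (hcreg : 0 ≤ creg) (hβ : 0 < β) :
    ∃ s₀ : ℕ, ∀ s : ℕ, s₀ ≤ s → ∃ c₀ e₁ : ℝ, 0 < c₀ ∧ 0 < e₁ ∧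
      ∀ (P : Params), P.d = d → P.L = L → ∀ {k : ℕ}, 1 ≤ k → k ≤ P.K → k + s ≤ P.m + P.K →
      3 * (L ^ k * L ^ s) ≤ P.sitesPerDir 0 →
      ∀ (Ω : Finset (Balaban1983to89.Site P 0)),
        (∀ z z' : Balaban1983to89.Site P 0,
          (∀ μ, (z μ).val / (L ^ k * L ^ s) = (z' μ).val / (L ^ k * L ^ s)) → (z ∈ Ω ↔ z' ∈ Ω)) →
      ∀ (A : PBond P 0 → ℝ) {ec : ℝ}, 0 < ec → ec ≤ e₁ →
      (∀ z ∈ Ω, ∀ μ ν : Fin P.d,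
          P.spacing k * |e| / ec * |A ⟨z.shift μ, ν⟩ - A ⟨z, ν⟩| ≤ creg * ec ^ (β - 1) / (L : ℝ) ^ k) →
      ∀ x ∈ (Finset.univ.filter fun x : Balaban1983to89.Site P 0 =>
          ∀ y, LatticeFieldCalculus.supDist x y ≤ 2 * (5 * (L ^ k * L ^ s) / 8 + L ^ k) + 2 * (L ^ k * L ^ s) * (d + 1) → y ∈ Ω),
      ∀ (f : Balaban1983to89.Site P 0 → ℂ) (F D : ℝ), (∀ y, ‖f y‖ ≤ F) → 0 ≤ D →
        (∀ y, f y ≠ 0 → D ≤ B5Ineq137Torus.T P 0 x y) →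
        ‖(gBox (B1RG242Torus.α P a k * (P.L : ℝ) ^ (k * P.d)) P.eps⁻¹ (expGauge P e A) k Ω *ᵥ f) x‖ ≤
          P.spacing k ^ 2 * (c₀ * Real.exp (-((1 / (4 * (L : ℝ) ^ s)) * (((P.L : ℝ) ^ k)⁻¹ * D))) * F) := by
  obtain ⟨s₀, hs₀⟩ := norm_gBox_mulVec_le d L hd hL ha e creg β hcreg hβ
  refine ⟨s₀, fun s hs => ?_⟩
  obtain ⟨c₀, e₁, hc₀, he₁, H⟩ := hs₀ s hs
  refine ⟨c₀, e₁, hc₀, he₁, ?_⟩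
  intro P hPd hPL k hk1 hkK hks hsize Ω hbig A ec hec hece hreg x hx f F D hF hD hsupp
  have hdeep := (Finset.mem_filter.1 hx).2
  have h := H P hPd hPL hk1 hkK hks hsize Ω hbig A hec hece hreg x hdeep f F D hF hD
    (fun z hz => by rw [← T_eq_supDist]; exact hsupp z hz)
  have hL0 : (0 : ℝ) < (L : ℝ) := by exact_mod_cast (show 0 < L by omega)
  have hPL' : (P.L : ℝ) = (L : ℝ) := by exact_mod_cast hPL
  have hexp : Real.exp (-(D / (4 * (L : ℝ) ^ s * (L : ℝ) ^ k))) =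
      Real.exp (-((1 / (4 * (L : ℝ) ^ s)) * (((P.L : ℝ) ^ k)⁻¹ * D))) := by
    rw [hPL']
    congr 1
    have h1 : (L : ℝ) ^ s ≠ 0 := pow_ne_zero _ hL0.ne'
    have h2 : (L : ℝ) ^ k ≠ 0 := pow_ne_zero _ hL0.ne'
    field_simp
  calc ‖(gBox (B1RG242Torus.α P a k * (P.L : ℝ) ^ (k * P.d)) P.eps⁻¹ (expGauge P e A) k Ω *ᵥ f) x‖
      ≤ c₀ * P.spacing k ^ 2 * Real.exp (-(D / (4 * (L : ℝ) ^ s * (L : ℝ) ^ k))) * F := h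
    _ = P.spacing k ^ 2 * (c₀ * Real.exp (-((1 / (4 * (L : ℝ) ^ s)) * (((P.L : ℝ) ^ k)⁻¹ * D))) * F) := by rw [hexp]; ring

/-- **(2.36) FOR THE REGION FORM `Δ_k(Ω, e^{ieεA})` AT A (2.23)-REGULAR NON-FLAT BACKGROUND, hypothesis-free** (p. 263: *"|Δ(x₁,x₂)| ≦
ce^{−c|x₁−x₂|}, (2.36)"* for the comparison object `Δ_k(Ω,u)` = [I] (4.6.4); [6] p. 573 *"for x with dist(x, Ω^c) ≥ R₀"*): with r01's constants,
for every torus, level, big-block region `Ω`, regular `A` as in `input110_regular`, and all unit-lattice points `y₁, y₂` such that every fine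
`x ∈ B^k(y₁)` has its `R₀`-ball inside `Ω`:  `‖Δ_k(Ω,e^{ieεA}; y₁,y₂)‖ ≤ A·([y₁ = y₂] + a_k·c₀e^{δ₀}·e^{−δ₀|y₁−y₂|_{T^{(k)}}})`, `δ₀ = 1/(4L^s)`,
`A = α_kL^{kd}` — this seat's `decay236_region_gen` BY NAME on `input110_regular`. [cite: BalabanImbrieJaffe1988, (2.36) p.263] -/
theorem decay236_region_regular (d L : ℕ) (hd : 1 ≤ d) (hL : 2 ≤ L) {a : ℝ} (ha : 0 < a) (e creg β : ℝ) (hcreg : 0 ≤ creg) (hβ : 0 < β) :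
    ∃ s₀ : ℕ, ∀ s : ℕ, s₀ ≤ s → ∃ c₀ e₁ : ℝ, 0 < c₀ ∧ 0 < e₁ ∧
      ∀ (P : Params), P.d = d → P.L = L → ∀ {k : ℕ}, 1 ≤ k → k ≤ P.K → k + s ≤ P.m + P.K →
      3 * (L ^ k * L ^ s) ≤ P.sitesPerDir 0 →
      ∀ (Ω : Finset (Balaban1983to89.Site P 0)),
        (∀ z z' : Balaban1983to89.Site P 0,
          (∀ μ, (z μ).val / (L ^ k * L ^ s) = (z' μ).val / (L ^ k * L ^ s)) → (z ∈ Ω ↔ z' ∈ Ω)) →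
      ∀ (A : PBond P 0 → ℝ) {ec : ℝ}, 0 < ec → ec ≤ e₁ →
      (∀ z ∈ Ω, ∀ μ ν : Fin P.d,
          P.spacing k * |e| / ec * |A ⟨z.shift μ, ν⟩ - A ⟨z, ν⟩| ≤ creg * ec ^ (β - 1) / (L : ℝ) ^ k) →
      ∀ (y₁ y₂ : Balaban1983to89.Site P (0 + k)),
        (∀ x ∈ blockK k y₁, ∀ y, LatticeFieldCalculus.supDist x y ≤ 2 * (5 * (L ^ k * L ^ s) / 8 + L ^ k) + 2 * (L ^ k * L ^ s) * (d + 1) →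
          y ∈ Ω) →
        ‖deltaRegion (B1RG242Torus.α P a k * (P.L : ℝ) ^ (k * P.d)) P.eps⁻¹ (expGauge P e A) k Ω y₁ y₂‖ ≤
          (B1RG242Torus.α P a k * (P.L : ℝ) ^ (k * P.d)) *
            ((if y₁ = y₂ then 1 else 0) + B1.aSeq a P.L k * (c₀ * Real.exp (1 / (4 * (L : ℝ) ^ s))) *
              Real.exp (-((1 / (4 * (L : ℝ) ^ s)) * B5Ineq137Torus.T P (0 + k) y₁ y₂))) := by
  obtain ⟨s₀, hs₀⟩ := input110_regular d L hd hL ha e creg β hcreg hβ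
  refine ⟨s₀, fun s hs => ?_⟩
  obtain ⟨c₀, e₁, hc₀, he₁, H⟩ := hs₀ s hs
  refine ⟨c₀, e₁, hc₀, he₁, ?_⟩
  intro P hPd hPL k hk1 hkK hks hsize Ω hbig A ec hec hece hreg y₁ y₂ hdeep
  have hk : 0 + k ≤ P.m + P.K := by omega
  have hL0 : (0 : ℝ) < (L : ℝ) := by exact_mod_cast (show 0 < L by omega)
  have hδ₀ : (0 : ℝ) ≤ 1 / (4 * (L : ℝ) ^ s) := by positivity
  exact decay236_region_gen hk1 hk ha P.eps⁻¹ (expGauge P e A) Ω _ hδ₀ hc₀.le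
    (fun x hx f F D hF hD hsupp => H P hPd hPL hk1 hkK hks hsize Ω hbig A hec hece hreg x hx f F D hF hD hsupp) y₁ y₂
    (fun x hx => Finset.mem_filter.2 ⟨Finset.mem_univ _, hdeep x hx⟩)

end

end Literature.MathematicalPhysics.QuantumFieldTheory.BalabanImbrieJaffe1984to88.BIJ88Decay236RegularRegion
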